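import Mathlib
import HarnessLib
import Summits.HubbardSuperconductivity.HubbardSuperconductivity.Theorems.KLProgrammeKLRegimeEngineTowerImportP2Count
import Summits.HubbardSuperconductivity.HubbardSuperconductivity.Theorems.KLProgrammeKLRegimeEngineAnisoLineFromPlain
import Summits.HubbardSuperconductivity.HubbardSuperconductivity.Theorems.KLProgrammeKLRegimeEngineKernelMomentumLipschitz

/-!
# Route `KLProgramme` — crux K3 ENGINE (stmt-HubbardSuperconductivity-20437 `KLRegimeEngineV17F2`), stub (b) v2 (ℓ), import (I4) at four legs, located risk #16
# «ι₂-PLAIN-LINE» (pen (R72h)): THE COMPOSED CONSUMER — the tower's levelled measured quartic size from the PLAIN pinned `L¹` line of the quartic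
# (cell gate-hubbard-kl, seat hubbard-kl-k3c2-p3 g9)

`…EngineAnisoLineFromPlain` (p586153): plain pinned `L¹ ≤ S` ⇒ `F_n`-sectorised all-fixed pinned `L¹ ≤ CA⁴·S` (stub binders; leg `0` pinned).
`…EngineTowerImportP2Count` (p585574): all-fixed line `Bₐ` (ANY leg pinned anywhere) ⇒ `klTowerMeasLev … d k 4 F ≤ klThinCountC·sectorCount(dk−1)·Bₐ` (thin-count doors).
The glue between «leg `0` pinned» and «any leg pinned» is translation invariance of the conserving polynomial `𝒱_j[K]` (`norm_sectorisedKernel_translate`,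
…EnginePlaneWaveConservation): §1 `sum_filter_leg_eq_sum_pinned` — for a translation-invariant `f` on position tuples, the sum over the fibre `{X : X p = x}` of ANY
leg `p` at ANY pin `x` equals the leg-`0` pinned sum `Σ_y f (x₁ :: y)`.  §2 composes: `∃ CA > 0` (absolute) such that under BOTH door sets — the stub binders (`P.WF`,
`R.WF2`, `c ≤ klEngC₃6`, `U ≤ klEngU₀9`, `klEngL₃`, `klEngM₃`, `FrameOK R U (nScales β) μ K`) AND the thin-count doors (`c ≤ klThinCountC₃ R`, `U ≤ klThinCountU₀ R`) — for
every block `k` with `1 ≤ dk − 1 ≤ nScales β + 1`: if the PLAIN four-leg kernel of the block input `𝒱_{dk}[K]` has pinned `L¹ ≤ S` at every pin and every spin/charge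
string, then **`klTowerMeasLev L M β U μ K d k 4 F ≤ klThinCountC · sectorCount (dk−1) · CA⁴ · S`** for every level-count `F` — `ι₂·λ = klThinCountC·CA⁴·S` in the kit's
four-leg units, `S = C_q·|U|` the day `PlainQuarticL1LineAt` has a producer (E1's (Q-ι₂)).
Proofs only; nothing about the model is asserted; nothing asserts superconductivity.
References: BGM 2006 §2.7 (2.71)/(2.71a), §2.8 (2.96) [cite: BenfattoGiulianiMastropietro2006].
-/

noncomputable section

namespace Summit.HubbardSuperconductivity.HubbardSuperconductivity.Theorems.EngineV8

set_option linter.dupNamespace false -- summit = problem name (single-conjunct summit), D-0017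

open Real Finset Literature.MathematicalPhysics.QuantumLattice Literature.Probability.LatticeModels GrassmannAlgebra
open Literature.MathematicalPhysics.QuantumLattice.FermiRG
open Summit.HubbardSuperconductivity.HubbardSuperconductivity.Theorems.KLRegimeSplit
open Summit.HubbardSuperconductivity.HubbardSuperconductivity.Theorems.KLProgrammeLegKernels
open Summit.HubbardSuperconductivity.HubbardSuperconductivity.Theorems.DispersionFlow
open Summit.HubbardSuperconductivity.HubbardSuperconductivity.Theorems.KLRegimeWick

variable {L M : ℕ} [NeZero L] [NeZero M]

/-! ## §1 Any pinned leg, any pin: translation invariance -/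

/-- **THE FIBRE SUM OF ANY LEG AT ANY PIN IS THE LEG-`0` PINNED SUM** for a translation-invariant function of position tuples:
`Σ_{X : X p = x} f X = Σ_{y} f (x₁ :: y)`. -/
theorem sum_filter_leg_eq_sum_pinned {m : ℕ} (f : (Fin (m + 1) → SpaceTimeIdx L M) → ℝ)
    (hf : ∀ (x : Fin (m + 1) → SpaceTimeIdx L M) (a : SpaceTimeIdx L M), f (fun i => ((x i).1 + a.1, (x i).2 + a.2)) = f x)
    (p : Fin (m + 1)) (x x₁ : SpaceTimeIdx L M) :
    ∑ X ∈ univ.filter (fun X : Fin (m + 1) → SpaceTimeIdx L M => X p = x), f X = ∑ y : Fin m → SpaceTimeIdx L M, f (Matrix.vecCons x₁ y) := by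
  classical
  haveI : NeZero (2 * M) := ⟨by have := NeZero.ne M; omega⟩
  -- (1) the fibre sum does not depend on the pin
  have hshift : ∀ x' : SpaceTimeIdx L M, ∑ X ∈ univ.filter (fun X : Fin (m + 1) → SpaceTimeIdx L M => X p = x), f X =
      ∑ X ∈ univ.filter (fun X : Fin (m + 1) → SpaceTimeIdx L M => X p = x'), f X := by
    intro x'
    set a : SpaceTimeIdx L M := (x'.1 - x.1, x'.2 - x.2) with ha
    have hxa : ((x.1 + a.1, x.2 + a.2) : SpaceTimeIdx L M) = x' := by rw [ha]; ext <;> simp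
    refine Finset.sum_equiv (Equiv.addRight (fun _ : Fin (m + 1) => a)) (fun X => ?_) (fun X hX => ?_)
    · simp only [mem_filter, mem_univ, true_and, Equiv.coe_addRight, Pi.add_apply]
      constructor
      · intro h; rw [h, ← hxa]; rfl
      · intro h
        have h' : X p + a = x + a := by rw [h, ← hxa]; rfl
        exact add_right_cancel h'
    · rw [Equiv.coe_addRight]
      exact (hf X a).symm
  -- (2) the total is `card ×` the fibre sum, and `card ×` the leg-0 pinned sum
  have hfib : ∑ X : Fin (m + 1) → SpaceTimeIdx L M, f X =
      Fintype.card (SpaceTimeIdx L M) * ∑ X ∈ univ.filter (fun X : Fin (m + 1) → SpaceTimeIdx L M => X p = x), f X := by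
    rw [← Finset.sum_fiberwise univ (fun X : Fin (m + 1) → SpaceTimeIdx L M => X p) f]
    rw [sum_congr rfl fun j _ => (hshift j).symm, sum_const, card_univ, nsmul_eq_mul]
  have hpin := sum_eq_card_mul_sum_pinned f hf x₁
  have hcard : (0 : ℝ) < Fintype.card (SpaceTimeIdx L M) := by exact_mod_cast Fintype.card_pos
  exact mul_left_cancel₀ hcard.ne' (hfib.symm.trans hpin)

/-- The sectorised kernel of the scale-`j` action is translation invariant in norm (conservation of frequency and momentum). -/
theorem norm_sectorisedKernel_klEffectiveAction_translate {N : ℕ} {β : ℝ} (hβ : β ≠ 0) (F : Fin N → FreqMomentum L M → ℂ) (U μ : ℝ) (K : TrigPolyC4v)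
    (e₀ : ℝ) (j m : ℕ) (Ω : Fin m → SectorLeg N) (x : Fin m → SpaceTimeIdx L M) (a : SpaceTimeIdx L M) :
    ‖sectorisedKernel L M β F (klEffectiveAction L M β U μ K e₀ j) m Ω (fun i => ((x i).1 + a.1, (x i).2 + a.2))‖ =
      ‖sectorisedKernel L M β F (klEffectiveAction L M β U μ K e₀ j) m Ω x‖ :=
  norm_sectorisedKernel_translate hβ F _ (fun _ _ hX => kernel_klEffectiveAction_eq_zero_of_freq β U μ K e₀ j hX)
    (fun m' X hX => klEffectiveAction_momentumConserving β U μ K e₀ j m' X hX) m Ω x a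

/-- **Leg-`0` line ⇒ any-leg line** for the sectorised quartic of `𝒱_j[K]`: if `fixedTupleL1 β 3 (W^F_4(𝒱_j[K])) Ω x₁ ≤ B` at every pin `x₁`, then for every leg `p`
and pin `x`, `ε³·Σ_{X : X p = x} ‖W^F_{4,Ω}(X)‖ ≤ B`. -/
theorem pinnedSum_le_of_fixedTupleL1_le {N : ℕ} {β : ℝ} (hβ : β ≠ 0) (F : Fin N → FreqMomentum L M → ℂ) (U μ : ℝ) (K : TrigPolyC4v) (e₀ : ℝ) (j : ℕ)
    (Ω : Fin 4 → SectorLeg N) {B : ℝ}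
    (hB : ∀ x₁ : SpaceTimeIdx L M, fixedTupleL1 L M β 3 (sectorisedKernel L M β F (klEffectiveAction L M β U μ K e₀ j) 4) Ω x₁ ≤ B)
    (p : Fin 4) (x : SpaceTimeIdx L M) :
    imagTimeWeight β M ^ 3 * ∑ X ∈ univ.filter (fun X : Fin 4 → SpaceTimeIdx L M => X p = x),
      ‖sectorisedKernel L M β F (klEffectiveAction L M β U μ K e₀ j) 4 Ω X‖ ≤ B := by
  rw [sum_filter_leg_eq_sum_pinned (fun X => ‖sectorisedKernel L M β F (klEffectiveAction L M β U μ K e₀ j) 4 Ω X‖)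
    (fun X a => norm_sectorisedKernel_klEffectiveAction_translate hβ F U μ K e₀ j 4 Ω X a) p x x]
  exact hB x

/-! ## §2 The composed consumer -/

/-- **(I4) AT FOUR LEGS FROM THE PLAIN LINE** (levelled track): `∃ CA > 0` absolute such that, under the stub binders and p4's thin-count doors, for every block
length `d`, block `k` with `1 ≤ dk − 1 ≤ nScales β + 1`, and `S ≥ 0`: if for all spin/charge strings `s, c` and every pin `y₀` the plain (trivial-family) four-leg
kernel of `𝒱_{dk}[K]` has `fixedTupleL1 … ((0, s i), c i) y₀ ≤ S`, then `klTowerMeasLev L M β U μ K d k 4 F ≤ klThinCountC · sectorCount (dk − 1) · (CA⁴ · S)`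
for every `F`. [cite: BenfattoGiulianiMastropietro2006, §2.7 (2.71a), §2.8 (2.96)] -/
theorem klTowerMeasLev_four_le_of_plainLine_klEng :
    ∃ CA : ℝ, 0 < CA ∧ ∀ (P : SplitConsts) (R : RenConsts) (c : ℝ), P.WF → R.WF2 → 0 < c → c ≤ klEngC₃6 P R → c ≤ klThinCountC₃ R →
      ∀ μ ∈ klWindowC, ∀ U : ℝ, 0 < U → U ≤ klEngU₀9 P R c → U ≤ klThinCountU₀ R → ∀ β : ℝ, klBetaMin ≤ β → β ≤ Real.exp (c / U ^ 2) →
      ∀ K : TrigPolyC4v, FrameOK R U (nScales β) μ K → ∀ (L M : ℕ) [NeZero L] [NeZero M],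
      klEngL₃ β U ≤ L → klEngM₃ β U L ≤ M → ∀ d k : ℕ, 1 ≤ d * k - 1 → d * k - 1 ≤ nScales β + 1 →
        ∀ S : ℝ, 0 ≤ S →
          (∀ (s c' : Fin 4 → Fin 2) (y₀ : SpaceTimeIdx L M),
            fixedTupleL1 L M β 3 (sectorisedKernel L M β (trivialMultiplier L M) (klTowerInput L M β U μ K d k) 4)
              (fun i => (((0 : Fin 1), s i), c' i)) y₀ ≤ S) →
          ∀ F : ℕ, klTowerMeasLev L M β U μ K d k 4 F ≤ klThinCountC * sectorCount (d * k - 1) * (CA ^ 4 * S) := by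
  obtain ⟨CA, hCA, h⟩ := fixedTupleL1_klAniso_le_of_plain_klEng
  refine ⟨CA, hCA, ?_⟩
  intro P R c hP hR2 hc hc6 hcT μ hμ U hU hU9 hUT β hβmin hβc K hK L M _ _ hL3 hM3 d k hn hnN S hS0 hS F
  have hRj : ∀ j, 0 ≤ R.Gfr j := gfr_nonneg_of_wf2 hR2
  have hβ0 : β ≠ 0 := (lt_of_lt_of_le (by norm_num [klBetaMin]) hβmin).ne'
  have hB : 0 ≤ CA ^ 4 * S := mul_nonneg (pow_nonneg hCA.le 4) hS0
  refine klTowerMeasLev_four_le_thinCount_mul hRj hc hcT hU hUT hβmin hβc hμ μ hK d k F hB ?_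
  intro Ω _ p x
  -- the aniso all-fixed line at leg 0 from the plain line (p586153), then any leg by translation invariance (§1)
  have hline0 : ∀ x₁ : SpaceTimeIdx L M,
      fixedTupleL1 L M β 3 (sectorisedKernel L M β (klAnisoFamily L M β μ K klE0 (d * k - 1)) (klTowerInput L M β U μ K d k) 4) Ω x₁ ≤
        CA ^ 4 * S := by
    intro x₁
    have hΩ : Ω = fun i => (((Ω i).1.1, (Ω i).1.2), (Ω i).2) := funext fun i => by simp
    rw [hΩ]
    exact h P R c hP hR2 hc hc6 μ hμ U hU hU9 β hβmin hβc K hK L M hL3 hM3 (d * k - 1) hn hnN (klTowerInput L M β U μ K d k)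
      (fun i => (Ω i).1.1) (fun i => (Ω i).1.2) (fun i => (Ω i).2) S hS0 (hS _ _) x₁
  unfold klTowerInput at hline0 ⊢
  exact pinnedSum_le_of_fixedTupleL1_le hβ0 _ U μ K klE0 (d * k) Ω hline0 p x

end Summit.HubbardSuperconductivity.HubbardSuperconductivity.Theorems.EngineV8

end
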